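import Summits.Ventures.PercRepro.ProfilePointedCircuitClassesLocalLym

/-!
# PercRepro — THE ONE-POINT PER-SET INEQUALITY AT NULLITY 3 IS A THEOREM (`n = 9`, `ρ = 6`, no coloops):
EVERY DEMAND HAS FOUR REPLACEMENT UNITS (p5, gen 47; `proofs/P5-GM1.md` §69 ADDENDUM 2)

On a coloop-free matroid with `9` points and rank `6`, for every `c ≠ e`:
`thru_3({c, e}) ≤ #{T ∈ BI_4 : c ∈ T, e ∉ T}` (`thruCount_three_pair_le_of_nullity_three`).  The certificate is
UNIFORM: every bi-independent `3`-set `X ∋ e` has at least FOUR bi-independent `4`-sets `T ⊇ X − e` avoiding `e`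
(`four_le_card_filter_replacement_three`), and a `4`-set `T ∋ c` contains at most three demands `{c, e, x}`
(`x ∈ T − c`), so `4 · #𝒟 ≤ 3 · #𝒰`.  Contrast: at nullity `4` the same one-point inequality is FALSE (§69 ADDENDUM 3:
an explicit GF(3) matroid with `16 > 12`) and the replacement relation only gives the factor two of
`thruCount_four_pair_le_two_mul` (three units per demand, six demands per unit).

THE FOUR UNITS. With `A := X − e` (two points), `B := E ∖ X` (a basis of six points) and `b` a point of the fundamental
circuit of `e` in `B` outside `cl A`: the partners `g ∈ B ∖ cl(A + b)` number at least `3` (at most three points of the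
basis `B` lie in the rank-`3` flat `cl(A + b)`; `three_le_card_filter_notMem_clF_insert_three`), each giving the unit
`A + b + g` (`insert_insert_erase_mem_biIndepSets_four`).  With four partners we are done; with exactly three, `e ∉ cl(A + b)`
(else `E − p₁ ⊆ cl(A + b) + p₂ + p₃` would have rank `≤ 5` and `p₁` would be a coloop), so the fundamental circuit has a second
point `b₂ ∉ cl(A + b)`; `b` is a partner of `b₂` and so are two further points `g ≠ b`, giving the units `A + b₂ + g`, which
avoid `b` and are therefore new: `3 + 2 ≥ 4`.
-/

open scoped Matroid

namespace PercRepro.Cogirth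

open Finset ThmH Skew Shadow Profile

variable {α : Type} [DecidableEq α] {N : Matroid α} [N.Finite]

section ReplacementNullityThree

/-- **THE REPLACEMENT UNIT LEMMA AT NULLITY 3**: for `X ∈ BI_3` with `e ∈ X`, `B := E ∖ X`, a point `b` of the
fundamental circuit of `e` in `B` outside `cl(X − e)` and a point `g ∈ B` outside `cl(X − e + b)`, the set
`T = (X − e) + b + g` is a bi-independent `4`-set avoiding `e`. -/
theorem insert_insert_erase_mem_biIndepSets_four {X : Finset α}
    (hX : X ∈ biIndepSets N 3) {e : α} (he : e ∈ X) {b g : α} (hb : b ∈ fundC N (gr N \ X) e)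
    (hbA : b ∉ clF N (X.erase e)) (hg : g ∈ gr N \ X) (hgcl : g ∉ clF N (insert b (X.erase e))) :
    insert g (insert b (X.erase e)) ∈ biIndepSets N 4 ∧ e ∉ insert g (insert b (X.erase e)) := by
  obtain ⟨hXg, hX3, hXrk, hXc⟩ := mem_biIndepSets.1 hX
  have heg : e ∈ gr N := hXg he
  have hBg : gr N \ X ⊆ gr N := sdiff_subset
  have heB : e ∉ gr N \ X := fun h => (mem_sdiff.1 h).2 he
  have hAg : X.erase e ⊆ gr N := (erase_subset _ _).trans hXg
  have hArk : rk N (X.erase e) = (X.erase e).card :=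
    rk_eq_card_of_subset_of_rk_eq_card (erase_subset _ _) hXrk
  have hA2 : (X.erase e).card = 2 := by rw [card_erase_of_mem he, hX3]
  have hbB : b ∈ gr N \ X := fundC_subset _ e hb
  have hbg : b ∈ gr N := hBg hbB
  have hbX : b ∉ X := (mem_sdiff.1 hbB).2
  have hbA' : b ∉ X.erase e := fun h => hbX (mem_of_mem_erase h)
  have heb : e ≠ b := fun h => hbX (h ▸ he)
  have heBb : e ∉ clF N ((gr N \ X).erase b) := by
    unfold fundC at hb
    exact (mem_filter.1 hb).2
  have hA1g : insert b (X.erase e) ⊆ gr N := insert_subset hbg hAg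
  have hA1rk : rk N (insert b (X.erase e)) = 3 := by
    rw [rk_insert_eq hbg hAg, if_neg hbA, hArk, hA2]
  have hA1card : (insert b (X.erase e)).card = 3 := by rw [card_insert_of_notMem hbA', hA2]
  have hgg : g ∈ gr N := hBg hg
  have hgX : g ∉ X := (mem_sdiff.1 hg).2
  have hgA1 : g ∉ insert b (X.erase e) := fun h => hgcl (subset_clF hA1g h)
  have heg' : e ≠ g := fun h => hgX (h ▸ he)
  refine ⟨?_, ?_⟩
  · rw [mem_biIndepSets]
    refine ⟨insert_subset hgg hA1g, ?_, ?_, ?_⟩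
    · rw [card_insert_of_notMem hgA1, hA1card]
    · rw [card_insert_of_notMem hgA1, rk_insert_eq hgg hA1g, if_neg hgcl, hA1rk, hA1card]
    · -- the complement lies in the independent set `(B − b) + e`
      have hBe : (gr N \ X).erase b ⊆ gr N := (erase_subset _ _).trans hBg
      have heBe : e ∉ (gr N \ X).erase b := fun h => heB (mem_of_mem_erase h)
      have hI : rk N (insert e ((gr N \ X).erase b)) = (insert e ((gr N \ X).erase b)).card := by
        rw [rk_insert_eq heg hBe, if_neg heBb, card_insert_of_notMem heBe,
          rk_eq_card_of_subset_of_rk_eq_card (erase_subset _ _) hXc]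
      apply rk_eq_card_of_subset_of_rk_eq_card _ hI
      intro x hx
      rw [mem_sdiff] at hx
      obtain ⟨hxg, hxT⟩ := hx
      rw [mem_insert]
      by_cases hxe : x = e
      · exact Or.inl hxe
      · right
        rw [mem_erase, mem_sdiff]
        refine ⟨?_, hxg, ?_⟩
        · intro hxb
          rw [hxb] at hxT
          exact hxT (mem_insert_of_mem (mem_insert_self b _))
        · intro hxX
          exact hxT (mem_insert_of_mem (mem_insert_of_mem (mem_erase.2 ⟨hxe, hxX⟩)))
  · rw [mem_insert, mem_insert]
    rintro (h | h | h)
    · exact heg' h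
    · exact heb h
    · exact (mem_erase.1 h).1 rfl

/-- **AT LEAST THREE PARTNERS**: on `#E = 9`, `ρ = 6`, for `X ∈ BI_3`, `e ∈ X` and a point `b ∈ E` outside
`cl(X − e)`, at least three points of the basis `B = E ∖ X` lie outside the rank-`3` flat `cl(X − e + b)`
(at most three points of the independent set `B` can lie in it). -/
theorem three_le_card_filter_notMem_clF_insert_three (hn : (gr N).card = 9) {X : Finset α}
    (hX : X ∈ biIndepSets N 3) {e : α} (he : e ∈ X) {b : α} (hbg : b ∈ gr N) (hbA : b ∉ clF N (X.erase e)) :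
    3 ≤ ((gr N \ X).filter (fun x => x ∉ clF N (insert b (X.erase e)))).card := by
  obtain ⟨hXg, hX3, hXrk, hXc⟩ := mem_biIndepSets.1 hX
  have hBcard : (gr N \ X).card = 6 := by rw [card_sdiff_of_subset hXg, hX3, hn]
  have hAg : X.erase e ⊆ gr N := (erase_subset _ _).trans hXg
  have hArk : rk N (X.erase e) = (X.erase e).card :=
    rk_eq_card_of_subset_of_rk_eq_card (erase_subset _ _) hXrk
  have hA2 : (X.erase e).card = 2 := by rw [card_erase_of_mem he, hX3]
  have hA1rk : rk N (insert b (X.erase e)) = 3 := by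
    rw [rk_insert_eq hbg hAg, if_neg hbA, hArk, hA2]
  have hS : ((gr N \ X).filter (fun x => x ∈ clF N (insert b (X.erase e)))).card ≤ 3 := by
    have h1 : rk N ((gr N \ X).filter (fun x => x ∈ clF N (insert b (X.erase e)))) =
        ((gr N \ X).filter (fun x => x ∈ clF N (insert b (X.erase e)))).card :=
      rk_eq_card_of_subset_of_rk_eq_card (filter_subset _ _) hXc
    have h2 : (gr N \ X).filter (fun x => x ∈ clF N (insert b (X.erase e))) ⊆
        clF N (insert b (X.erase e)) := fun x hx => (mem_filter.1 hx).2
    have h3 := rk_le_rk_of_subset_finset (M := N) h2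
    rw [rk_clF_eq_rk, hA1rk] at h3
    omega
  have hsplit := card_filter_add_card_filter_not (s := gr N \ X)
    (p := fun x => x ∈ clF N (insert b (X.erase e)))
  omega

/-- The partners of a fixed point `b` inject into the units through `X − e + b`: `#P ≤ #{T ∈ BI_4 : e ∉ T, X − e ⊆ T}`
for `P := {g ∈ E ∖ X : g ∉ cl(X − e + b)}`, via `g ↦ X − e + b + g`. -/
theorem card_filter_notMem_clF_le_card_filter_replacement_three
    {X : Finset α} (hX : X ∈ biIndepSets N 3) {e : α} (he : e ∈ X) {b : α}
    (hb : b ∈ fundC N (gr N \ X) e) (hbA : b ∉ clF N (X.erase e)) :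
    ((gr N \ X).filter (fun x => x ∉ clF N (insert b (X.erase e)))).card ≤
      ((biIndepSets N 4).filter (fun T => e ∉ T ∧ X.erase e ⊆ T)).card := by
  have hBg : gr N \ X ⊆ gr N := sdiff_subset
  have hAg : X.erase e ⊆ gr N := (erase_subset _ _).trans ((mem_biIndepSets.1 hX).1)
  have hA1g : insert b (X.erase e) ⊆ gr N := insert_subset (hBg (fundC_subset _ e hb)) hAg
  apply card_le_card_of_injOn (fun g => insert g (insert b (X.erase e)))
  · intro g hg
    rw [mem_coe, mem_filter] at hg
    have hT := insert_insert_erase_mem_biIndepSets_four hX he hb hbA hg.1 hg.2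
    show insert g (insert b (X.erase e)) ∈ (biIndepSets N 4).filter (fun T => e ∉ T ∧ X.erase e ⊆ T)
    exact mem_filter.2 ⟨hT.1, hT.2, fun x hx => mem_insert_of_mem (mem_insert_of_mem hx)⟩
  · intro g₁ hg₁ g₂ hg₂ h
    rw [mem_coe, mem_filter] at hg₁ hg₂
    have hg₁A1 : g₁ ∉ insert b (X.erase e) := fun h' => hg₁.2 (subset_clF hA1g h')
    have h' : insert g₁ (insert b (X.erase e)) = insert g₂ (insert b (X.erase e)) := h
    have : g₁ ∈ insert g₂ (insert b (X.erase e)) := by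
      rw [← h']
      exact mem_insert_self g₁ _
    rw [mem_insert] at this
    rcases this with h' | h'
    · exact h'
    · exact absurd h' hg₁A1

/-- **EVERY DEMAND HAS FOUR REPLACEMENT UNITS**: on a coloop-free matroid with `#E = 9` and `ρ = 6`, every
bi-independent `3`-set `X ∋ e` has at least four bi-independent `4`-sets `T ⊇ X − e` avoiding `e`. -/
theorem four_le_card_filter_replacement_three (hn : (gr N).card = 9) (hR : rk N (gr N) = 6)
    (hcf : ∀ x ∈ gr N, rk N ((gr N).erase x) = 6) {X : Finset α} (hX : X ∈ biIndepSets N 3) {e : α}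
    (he : e ∈ X) : 4 ≤ ((biIndepSets N 4).filter (fun T => e ∉ T ∧ X.erase e ⊆ T)).card := by
  obtain ⟨hXg, hX3, hXrk, hXc⟩ := mem_biIndepSets.1 hX
  have heg : e ∈ gr N := hXg he
  have hBg : gr N \ X ⊆ gr N := sdiff_subset
  have hBcard : (gr N \ X).card = 6 := by rw [card_sdiff_of_subset hXg, hX3, hn]
  have hBrk : rk N (gr N \ X) = rk N (gr N) := by rw [hXc, hBcard, hR]
  have hecl : e ∈ clF N (gr N \ X) := by
    rw [mem_clF_iff_rk_insert_eq heg hBg]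
    have h1 := rk_le_rk_gr (M := N) (insert_subset heg hBg)
    have h2 := rk_le_rk_of_subset_finset (M := N) (subset_insert e (gr N \ X))
    omega
  have hAg : X.erase e ⊆ gr N := (erase_subset _ _).trans hXg
  have heA : e ∉ clF N (X.erase e) := notMem_clF_erase_of_indep (indep_of_rk_eq_card' hXrk) he
  have hCcl : e ∈ clF N (fundC N (gr N \ X) e) := mem_clF_fundC heg hBg hXc hecl
  -- the first point `b` of the fundamental circuit outside `cl A`
  obtain ⟨b, hbC, hbA⟩ : ∃ b ∈ fundC N (gr N \ X) e, b ∉ clF N (X.erase e) := by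
    by_contra hcon
    have hsub : fundC N (gr N \ X) e ⊆ clF N (X.erase e) :=
      fun x hx => by_contra (fun h => hcon ⟨x, hx, h⟩)
    exact heA (mem_clF_of_mem_clF_clF hAg (mem_clF_of_subset hsub hCcl))
  have hbB : b ∈ gr N \ X := fundC_subset _ e hbC
  have hbg : b ∈ gr N := hBg hbB
  have hbA' : b ∉ X.erase e := fun h => (mem_sdiff.1 hbB).2 (mem_of_mem_erase h)
  have hA1g : insert b (X.erase e) ⊆ gr N := insert_subset hbg hAg
  have hinj₁ := card_filter_notMem_clF_le_card_filter_replacement_three hX he hbC hbA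
  set P₁ := (gr N \ X).filter (fun x => x ∉ clF N (insert b (X.erase e))) with hP₁def
  have hP₁ : 3 ≤ P₁.card := three_le_card_filter_notMem_clF_insert_three hn hX he hbg hbA
  by_cases h4 : 4 ≤ P₁.card
  · -- four partners of `b`
    omega
  · -- exactly three partners `p₁, p₂, p₃`: then `e ∉ cl(A + b)`, else `p₁` would be a coloop
    have hP₁3 : P₁.card = 3 := by omega
    obtain ⟨p₁, hp₁, p₂, hp₂, p₃, hp₃, hp₁₂, hp₁₃, hp₂₃⟩ : ∃ p₁ ∈ P₁, ∃ p₂ ∈ P₁, ∃ p₃ ∈ P₁,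
        p₁ ≠ p₂ ∧ p₁ ≠ p₃ ∧ p₂ ≠ p₃ := by
      rw [card_eq_three] at hP₁3
      obtain ⟨x, y, z, hxy, hxz, hyz, hP⟩ := hP₁3
      refine ⟨x, ?_, y, ?_, z, ?_, hxy, hxz, hyz⟩ <;> rw [hP] <;> simp
    have hP₁eq : ∀ x ∈ P₁, x = p₁ ∨ x = p₂ ∨ x = p₃ := by
      intro x hx
      by_contra hcon
      rw [not_or, not_or] at hcon
      have hsub : insert x (insert p₁ (insert p₂ ({p₃} : Finset α))) ⊆ P₁ := by
        intro y hy
        rw [mem_insert, mem_insert, mem_insert, mem_singleton] at hy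
        rcases hy with rfl | rfl | rfl | rfl
        · exact hx
        · exact hp₁
        · exact hp₂
        · exact hp₃
      have hcard : (insert x (insert p₁ (insert p₂ ({p₃} : Finset α)))).card = 4 := by
        rw [card_insert_of_notMem, card_insert_of_notMem, card_insert_of_notMem, card_singleton]
        · rw [mem_singleton]; exact hp₂₃
        · rw [mem_insert, mem_singleton]; rintro (h | h)
          · exact hp₁₂ h
          · exact hp₁₃ h
        · rw [mem_insert, mem_insert, mem_singleton]; rintro (h | h | h)
          · exact hcon.1 h
          · exact hcon.2.1 h
          · exact hcon.2.2 h
      have := card_le_card hsub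
      omega
    rw [hP₁def, mem_filter] at hp₁ hp₂ hp₃
    have hecl' : e ∉ clF N (insert b (X.erase e)) := by
      intro hecl'
      have hsub : (gr N).erase p₁ ⊆ insert p₂ (insert p₃ (clF N (insert b (X.erase e)))) := by
        intro x hx
        rw [mem_erase] at hx
        obtain ⟨hxp, hxg⟩ := hx
        rw [mem_insert, mem_insert]
        by_cases hx2 : x = p₂
        · exact Or.inl hx2
        · by_cases hx3 : x = p₃
          · exact Or.inr (Or.inl hx3)
          · right; right
            by_cases hxX : x ∈ X
            · by_cases hxe : x = e
              · rw [hxe]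
                exact hecl'
              · exact subset_clF hA1g (mem_insert_of_mem (mem_erase.2 ⟨hxe, hxX⟩))
            · by_contra hxcl
              have hxP : x ∈ P₁ := by
                rw [hP₁def, mem_filter]
                exact ⟨mem_sdiff.2 ⟨hxg, hxX⟩, hxcl⟩
              rcases hP₁eq x hxP with h | h | h
              · exact hxp h
              · exact hx2 h
              · exact hx3 h
      have h1 := rk_le_rk_of_subset_finset (M := N) hsub
      have h2 := rk_insert_le (M := N) p₂ (insert p₃ (clF N (insert b (X.erase e))))
      have h2' := rk_insert_le (M := N) p₃ (clF N (insert b (X.erase e)))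
      have h4 := hcf p₁ (hBg hp₁.1)
      have hArk : rk N (X.erase e) = (X.erase e).card :=
        rk_eq_card_of_subset_of_rk_eq_card (erase_subset _ _) hXrk
      have hA2 : (X.erase e).card = 2 := by rw [card_erase_of_mem he, hX3]
      have hA1rk : rk N (insert b (X.erase e)) = 3 := by
        rw [rk_insert_eq hbg hAg, if_neg hbA, hArk, hA2]
      rw [rk_clF_eq_rk, hA1rk] at h2'
      omega
    -- a second point `b₂` of the fundamental circuit outside `cl(A + b)`
    obtain ⟨b₂, hb₂C, hb₂cl⟩ : ∃ b₂ ∈ fundC N (gr N \ X) e, b₂ ∉ clF N (insert b (X.erase e)) := by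
      by_contra hcon
      have hsub : fundC N (gr N \ X) e ⊆ clF N (insert b (X.erase e)) :=
        fun x hx => by_contra (fun h => hcon ⟨x, hx, h⟩)
      exact hecl' (mem_clF_of_mem_clF_clF hA1g (mem_clF_of_subset hsub hCcl))
    have hb₂A : b₂ ∉ clF N (X.erase e) := fun h => hb₂cl (clF_mono (subset_insert b _) h)
    have hb₂b : b₂ ≠ b := fun h => hb₂cl (h ▸ subset_clF hA1g (mem_insert_self b _))
    have hb₂g : b₂ ∈ gr N := hBg (fundC_subset _ e hb₂C)
    have hA2g : insert b₂ (X.erase e) ⊆ gr N := insert_subset hb₂g hAg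
    -- the partners of `b₂`, minus `b`: at least two
    set P₂ := ((gr N \ X).filter (fun x => x ∉ clF N (insert b₂ (X.erase e)))).erase b with hP₂def
    have hP₂ : 2 ≤ P₂.card := by
      have h3 := three_le_card_filter_notMem_clF_insert_three hn hX he hb₂g hb₂A
      have := card_erase_le (s := (gr N \ X).filter (fun x => x ∉ clF N (insert b₂ (X.erase e)))) (a := b)
      have h' := card_erase_add_one (s := (gr N \ X).filter (fun x => x ∉ clF N (insert b₂ (X.erase e)))) (a := b) ?_
      · rw [hP₂def]; omega
      · rw [mem_filter]
        refine ⟨hbB, ?_⟩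
        -- `b ∉ cl(A + b₂)`: else the two rank-3 flats coincide and `b₂ ∈ cl(A + b)`
        intro hbcl
        have hArk : rk N (X.erase e) = (X.erase e).card :=
          rk_eq_card_of_subset_of_rk_eq_card (erase_subset _ _) hXrk
        have hA2 : (X.erase e).card = 2 := by rw [card_erase_of_mem he, hX3]
        have hA1rk : rk N (insert b (X.erase e)) = 3 := by
          rw [rk_insert_eq hbg hAg, if_neg hbA, hArk, hA2]
        have hA2rk : rk N (insert b₂ (X.erase e)) = 3 := by
          rw [rk_insert_eq hb₂g hAg, if_neg hb₂A, hArk, hA2]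
        -- `A + b + b₂ ⊆ cl(A + b₂)` has rank `≤ 3 = rk(A + b)`, so `b₂ ∈ cl(A + b)`
        have hsub : insert b₂ (insert b (X.erase e)) ⊆ clF N (insert b₂ (X.erase e)) := by
          intro x hx
          rw [mem_insert, mem_insert] at hx
          rcases hx with rfl | rfl | hx
          · exact subset_clF hA2g (mem_insert_self _ _)
          · exact hbcl
          · exact subset_clF hA2g (mem_insert_of_mem hx)
        have h1 := rk_le_rk_of_subset_finset (M := N) hsub
        rw [rk_clF_eq_rk, hA2rk] at h1
        have h2 := rk_le_rk_of_subset_finset (M := N) (subset_insert b₂ (insert b (X.erase e)))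
        rw [hA1rk] at h2
        apply hb₂cl
        rw [mem_clF_iff_rk_insert_eq hb₂g hA1g, hA1rk]
        omega
    -- the two families of units are disjoint: the units through `b` and the units avoiding `b`
    have hinj₂ : P₂.card ≤ (((biIndepSets N 4).filter (fun T => e ∉ T ∧ X.erase e ⊆ T)).filter
        (fun T => b ∉ T)).card := by
      apply card_le_card_of_injOn (fun g => insert g (insert b₂ (X.erase e)))
      · intro g hg
        rw [mem_coe, hP₂def, mem_erase, mem_filter] at hg
        have hT := insert_insert_erase_mem_biIndepSets_four hX he hb₂C hb₂A hg.2.1 hg.2.2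
        show insert g (insert b₂ (X.erase e)) ∈ ((biIndepSets N 4).filter
          (fun T => e ∉ T ∧ X.erase e ⊆ T)).filter (fun T => b ∉ T)
        rw [mem_filter, mem_filter]
        refine ⟨⟨hT.1, hT.2, fun x hx => mem_insert_of_mem (mem_insert_of_mem hx)⟩, ?_⟩
        rw [mem_insert, mem_insert]
        rintro (h | h | h)
        · exact hg.1 h.symm
        · exact hb₂b h.symm
        · exact hbA' h
      · intro g₁ hg₁ g₂ hg₂ h
        rw [mem_coe, hP₂def, mem_erase, mem_filter] at hg₁ hg₂
        have hg₁A : g₁ ∉ insert b₂ (X.erase e) := fun h' => hg₁.2.2 (subset_clF hA2g h')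
        have h' : insert g₁ (insert b₂ (X.erase e)) = insert g₂ (insert b₂ (X.erase e)) := h
        have : g₁ ∈ insert g₂ (insert b₂ (X.erase e)) := by
          rw [← h']
          exact mem_insert_self g₁ _
        rw [mem_insert] at this
        rcases this with h' | h'
        · exact h'
        · exact absurd h' hg₁A
    have hinj₁' : P₁.card ≤ (((biIndepSets N 4).filter (fun T => e ∉ T ∧ X.erase e ⊆ T)).filter
        (fun T => b ∈ T)).card := by
      apply card_le_card_of_injOn (fun g => insert g (insert b (X.erase e)))
      · intro g hg
        rw [mem_coe, hP₁def, mem_filter] at hg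
        have hT := insert_insert_erase_mem_biIndepSets_four hX he hbC hbA hg.1 hg.2
        show insert g (insert b (X.erase e)) ∈ ((biIndepSets N 4).filter
          (fun T => e ∉ T ∧ X.erase e ⊆ T)).filter (fun T => b ∈ T)
        rw [mem_filter, mem_filter]
        exact ⟨⟨hT.1, hT.2, fun x hx => mem_insert_of_mem (mem_insert_of_mem hx)⟩,
          mem_insert_of_mem (mem_insert_self b _)⟩
      · intro g₁ hg₁ g₂ hg₂ h
        rw [mem_coe, hP₁def, mem_filter] at hg₁ hg₂
        have hg₁A : g₁ ∉ insert b (X.erase e) := fun h' => hg₁.2 (subset_clF hA1g h')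
        have h' : insert g₁ (insert b (X.erase e)) = insert g₂ (insert b (X.erase e)) := h
        have : g₁ ∈ insert g₂ (insert b (X.erase e)) := by
          rw [← h']
          exact mem_insert_self g₁ _
        rw [mem_insert] at this
        rcases this with h' | h'
        · exact h'
        · exact absurd h' hg₁A
    have hsplit := card_filter_add_card_filter_not
      (s := (biIndepSets N 4).filter (fun T => e ∉ T ∧ X.erase e ⊆ T)) (p := fun T => b ∈ T)
    omega

end ReplacementNullityThree

end PercRepro.Cogirth
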